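import Mathlib
import Summits.ResolutionOfSingularities.ResolutionOfSingularities.Theorems.RadicialJungCleanModelsCleanProp44TauOneVeryNear
import HarnessLib

/-!
# Route `RadicialJung`, crux `CleanModels` (stmt-ResolutionOfSingularities-15917), line `Sketch` rev 35, stub 6 `stub_cleanProp44` (X44c):
# X44c for a FINITE `μ`-stratum without very near points

Seat decomp-res-hand-2 g15 (structural hand), continuation of ✓ `…CleanProp44TauOneVeryNear.lean`.  By clean finite patching
(✓ `exists_isCleanPermissibleSeq_lt_of_finite_of_forall_nhds`, hand-2 g11) over the V-relative slices — the coheight-2 point slice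
✓ `exists_isCleanPermissibleSeq_lt_comap_of_isolated_coheight_two` and the new «isolated point without very near points» slice
✓ `exists_isCleanPermissibleSeq_lt_comap_of_isolated_of_forall_near_two_le` (which covers `τ ≥ 2` AND `τ = 1` threefold points alike) —:

* `exists_isCleanPermissibleSeq_lt_of_finite_of_forall_near_two_le` — **X44c's conclusion when the `μ`-stratum is a FINITE set of closed
  points NONE OF WHOSE THREEFOLD POINTS HAS A VERY NEAR POINT** (for every open `V ∋ x` and every blowing up of `V` at `x`, the closed threefold
  near points of `x` have `τ ≥ 2`; automatic at `τ ≥ 2` points by [CoP1] Lemma 4.3 (1)/(3), a genuine condition at `τ = 1` points).  Stage-free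
  currency: `X` integral Noetherian regular quasi-excellent of dimension `≤ 3`, `char K(X) = p`, the line of `G` clean-regular at every point.
* `cleanProp44_of_finite_of_forall_near_two_le` — the same on the stages of `stub_cleanProp44` (binders verbatim + the finite-stratum data).

Honest framing: OURS; nothing here proves X44c in general, any case of `CleanModels`, or resolution of singularities in characteristic `p`.
[cite: CossartPiltant2008, Prop. 4.2 (b), Lemma 4.3, Prop. 4.4 (proof, pp. 10–11)] [cite: Piltant2013, Prop. 5.1 (proof, Step 2)]
-/

noncomputable section

set_option linter.dupNamespace false -- mandated namespace of this single-conjunct summit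

open CategoryTheory CategoryTheory.Limits AlgebraicGeometry TopologicalSpace IsLocalRing
open Literature.AlgebraicGeometry.Resolution Literature.AlgebraicGeometry.Motives
open Scheme.IdealSheafData
open Summit.ResolutionOfSingularities.ResolutionOfSingularities.Theorems.CP2008Prop44

namespace Summit.ResolutionOfSingularities.ResolutionOfSingularities.Theorems.RadicialJung.CleanModels

set_option maxHeartbeats 800000 in
-- the per-point case analysis under the patching lemma
/-- **X44c's conclusion for a FINITE `μ`-stratum without very near points** (stage-free currency).  See the module docstring.
[cite: CossartPiltant2008, Prop. 4.2 (b), Lemma 4.3, Prop. 4.4 (proof, pp. 10–11)] [cite: Piltant2013, Prop. 5.1 (proof, Step 2)] -/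
theorem exists_isCleanPermissibleSeq_lt_of_finite_of_forall_near_two_le {p : ℕ} (hp : p.Prime) {X : Scheme.{0}} [IsIntegral X]
    [IsNoetherian X] [hcharX : CharP X.functionField p] (hX : Scheme.IsRegular X) (hqe : Scheme.IsQuasiExcellent X)
    (hX3 : topologicalKrullDim X ≤ 3) (G : X.functionField)
    (hG : ∀ x : X, CleanRegAt p (algebraMap (X.presheaf.stalk x) X.functionField) G)
    (J : X.IdealSheafData) {m : ℕ} (hm : 1 ≤ m) (hle : ∀ z, idealOrder J z ≤ m) (hcodim : ∀ z ∈ J.support, 1 < Order.coheight z)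
    (S : Set X) (hS : S.Finite) (hSc : ∀ x ∈ S, IsClosed ({x} : Set X))
    (hJS : ∀ x : X, (m : ℕ∞) ≤ idealOrder J x → x ∈ S) (hord : ∀ x ∈ S, idealOrder J x = m)
    (hvn : ∀ x ∈ S, (maximalIdeal (X.presheaf.stalk x)).spanFinrank = 3 → ∀ (V : X.Opens) (hxV : x ∈ V)
      (hclV : IsClosed ({(⟨x, hxV⟩ : (V : Scheme.{0}))} : Set (V : Scheme.{0})))
      (V₁ : Scheme.{0}) (π₁ : V₁ ⟶ (V : Scheme.{0})), IsBlowup π₁ (vanishingIdeal ⟨{(⟨x, hxV⟩ : (V : Scheme.{0}))}, hclV⟩) →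
      ∀ x' : V₁, IsClosed ({x'} : Set V₁) → π₁ x' = ⟨x, hxV⟩ →
        idealOrder (controlledTransform π₁ (vanishingIdeal ⟨{(⟨x, hxV⟩ : (V : Scheme.{0}))}, hclV⟩) (J.comap V.ι) m) x' = m →
        (maximalIdeal (V₁.presheaf.stalk x')).spanFinrank = 3 →
        ∀ hr : IsRegularLocalRing (V₁.presheaf.stalk x'),
          2 ≤ @stalkTau V₁ (controlledTransform π₁ (vanishingIdeal ⟨{(⟨x, hxV⟩ : (V : Scheme.{0}))}, hclV⟩) (J.comap V.ι) m) x' hr m) :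
    ∃ (X' : Scheme.{0}) (π : X' ⟶ X) (_ : IsIntegral X') (_ : IsDominant π) (J' : X'.IdealSheafData),
      IsCleanPermissibleSeq p π J m J' G ∧ ∀ x, idealOrder J' x < m := by
  have hcoh3 : ∀ z : X, Order.coheight z ≤ 3 := (topologicalKrullDim_le_iff_forall_coheight_le X 3).mp hX3
  refine exists_isCleanPermissibleSeq_lt_of_finite_of_forall_nhds J G S hS hSc hJS fun x hx => ?_
  -- the open `V = X ∖ (S ∖ {x})` isolates `x` in the stratum
  have hcl : IsClosed (S \ {x}) :=
    isClosed_of_finite_of_isClosed_singleton (hS.subset Set.sdiff_subset) fun y hy => hSc y hy.1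
  let V : X.Opens := ⟨(S \ {x})ᶜ, hcl.isOpen_compl⟩
  have hxV : x ∈ V := fun h => h.2 rfl
  have hbad : ∀ z : X, (m : ℕ∞) ≤ idealOrder J z → z = x ∨ z ∉ (V : Set X) := by
    intro z hz
    by_cases hzx : z = x
    · exact Or.inl hzx
    · exact Or.inr fun h => h ⟨hJS z hz, hzx⟩
  refine ⟨V, hxV, fun {_ _} => ?_⟩
  haveI hrx : IsRegularLocalRing (X.presheaf.stalk x) := hX x
  -- `x` is a point of the stratum: coheight `2` or `3`
  have hxsupp : x ∈ J.support := by
    rw [← one_le_idealOrder_iff, hord x hx]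
    exact_mod_cast hm
  have h1 : 1 < Order.coheight x := hcodim x hxsupp
  by_cases hd : (maximalIdeal (X.presheaf.stalk x)).spanFinrank = 3
  · -- a threefold point: the «no very near point» slice
    exact exists_isCleanPermissibleSeq_lt_comap_of_isolated_of_forall_near_two_le hp hX hqe hX3 G hG J hm hle hcodim V x hxV hbad
      (hord x hx) hd (hvn x hx hd V hxV)
  · -- a coheight-2 point: the local-dimension-two slice
    have hcoh3x : Order.coheight x ≠ 3 := by
      intro hc
      apply hd
      have h := CampaignW46.coheight_eq_spanFinrank x
      rw [hc] at h
      exact_mod_cast h.symm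
    have hcoh2 : Order.coheight x = 2 := by
      have h3 := hcoh3 x
      generalize hc : Order.coheight x = c at h1 h3 hcoh3x
      induction c using ENat.recTopCoe with
      | top => exact absurd h3 (by simp)
      | coe k =>
        have h1' : 1 < k := by exact_mod_cast h1
        have h3' : k ≤ 3 := by exact_mod_cast h3
        have hne3 : k ≠ 3 := fun h => hcoh3x (by rw [h]; rfl)
        have : k = 2 := by omega
        rw [this]
        rfl
    exact exists_isCleanPermissibleSeq_lt_comap_of_isolated_coheight_two hp hX J hm hle hcodim G hG V x hxV (hSc x hx) hbad (hord x hx) hcoh2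

set_option maxHeartbeats 800000 in
-- long binder list
/-- **X44c (`stub_cleanProp44`) for a FINITE `μ`-stratum without very near points.**  The binders of `stub_cleanProp44` VERBATIM, plus: the points
of order `μ` form a finite set `S` of closed points, none of whose threefold points has a very near point (hypothesis `hvn` of
`exists_isCleanPermissibleSeq_lt_of_finite_of_forall_near_two_le`).  Conclusion: the conclusion of `stub_cleanProp44` verbatim.
[cite: CossartPiltant2008, Prop. 4.4] -/
theorem cleanProp44_of_finite_of_forall_near_two_le :
    ∀ (p : ℕ), p.Prime → ∀ (S₀ : Scheme.{0}) [IsIntegral S₀] [IsNoetherian S₀],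
      CharP S₀.functionField p → Scheme.IsRegular S₀ → Scheme.IsExcellent S₀ → topologicalKrullDim S₀ = 3 →
      ∀ G₀ : S₀.functionField, (∀ s : S₀, CleanRegAt p (algebraMap (S₀.presheaf.stalk s) S₀.functionField) G₀) →
      ∀ I : S₀.IdealSheafData, I ≠ ⊥ →
      ∀ (X : Scheme.{0}) (ρ : X ⟶ S₀) [IsIntegral X] [IsNoetherian X] [IsDominant ρ],
        IsCleanRegularCentreBlowupSeq p ρ I G₀ →
        (∀ x : X, CleanRegAt p (algebraMap (X.presheaf.stalk x) X.functionField) (RatFn.functionFieldMap ρ G₀)) →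
        ∀ (J : X.IdealSheafData) (μ : ℕ), 1 ≤ μ →
          (∀ x ∈ J.support, 1 < Order.coheight x) → (∀ x, idealOrder J x ≤ μ) → (∃ x, idealOrder J x = μ) →
          ∀ (S : Set X), S.Finite → (∀ x ∈ S, IsClosed ({x} : Set X)) → (∀ x : X, (μ : ℕ∞) ≤ idealOrder J x → x ∈ S) →
          (∀ x ∈ S, idealOrder J x = μ) →
          (∀ x ∈ S, (maximalIdeal (X.presheaf.stalk x)).spanFinrank = 3 → ∀ (V : X.Opens) (hxV : x ∈ V)
            (hclV : IsClosed ({(⟨x, hxV⟩ : (V : Scheme.{0}))} : Set (V : Scheme.{0})))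
            (V₁ : Scheme.{0}) (π₁ : V₁ ⟶ (V : Scheme.{0})), IsBlowup π₁ (vanishingIdeal ⟨{(⟨x, hxV⟩ : (V : Scheme.{0}))}, hclV⟩) →
            ∀ x' : V₁, IsClosed ({x'} : Set V₁) → π₁ x' = ⟨x, hxV⟩ →
              idealOrder (controlledTransform π₁ (vanishingIdeal ⟨{(⟨x, hxV⟩ : (V : Scheme.{0}))}, hclV⟩) (J.comap V.ι) μ) x' = μ →
              (maximalIdeal (V₁.presheaf.stalk x')).spanFinrank = 3 →
              ∀ hr : IsRegularLocalRing (V₁.presheaf.stalk x'),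
                2 ≤ @stalkTau V₁ (controlledTransform π₁ (vanishingIdeal ⟨{(⟨x, hxV⟩ : (V : Scheme.{0}))}, hclV⟩) (J.comap V.ι) μ) x' hr μ) →
          ∃ (X' : Scheme.{0}) (π : X' ⟶ X) (_ : IsIntegral X') (_ : IsDominant π) (J' : X'.IdealSheafData),
            IsCleanPermissibleSeq p π J μ J' (RatFn.functionFieldMap ρ G₀) ∧ ∀ x, idealOrder J' x < μ := by
  intro p hp S₀ _ _ hchar hS₀ hexc hdimS G₀ _ I _ X ρ _ _ _ hρ hG J μ hμ hcodim hle _ S hS hSc hJS hord hvn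
  have hρ' : IsRegularCentreBlowupSeq ρ I := hρ.isRegularCentreBlowupSeq
  have hX : Scheme.IsRegular X := hρ'.isRegular hS₀
  have hqe : Scheme.IsQuasiExcellent X := hρ'.isQuasiExcellent hexc
  have hX3 : topologicalKrullDim X ≤ 3 := CP2008Prop44.topologicalKrullDim_stage_le hρ' inferInstance (n := 3) hdimS.le
  haveI hcharX : CharP X.functionField p := charP_of_injective_ringHom (RatFn.functionFieldMap ρ).injective p
  exact exists_isCleanPermissibleSeq_lt_of_finite_of_forall_near_two_le hp hX hqe hX3 (RatFn.functionFieldMap ρ G₀) hG J hμ hle hcodim S hS hSc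
    hJS hord hvn

end Summit.ResolutionOfSingularities.ResolutionOfSingularities.Theorems.RadicialJung.CleanModels

end
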